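import Mathlib
import Literature.Barriers.PneNP.MonotoneGapPerfectMatchingProofs
import HarnessLib

/-!
# Crux `NNLinearDegreeCofactorHard` (stmt-ValiantsHypothesis-23918), line `internal_cofactor`, rung S11:
# anti-concentration of a binomial count (piece (B‴-b) of `Lines/internal_cofactor-S2b-D3plan.md`)

The exponent-2 rung S11 (`nnInternalCofactorQuasiPolyHard`, SPEC §S11) needs, besides tests, an ANTI-CONCENTRATION bound for
«alignment gates»: the number of popping pairs among `ℓ` free inflate pairs of `inflateWord` is a Binomial(`ℓ`, 1/2) count, and a
gate asks it to hit one prescribed value.  This file records the counting estimate in the tree's style (no probability spaces):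

* `succ_mul_choose_sq_le` — `(ℓ + 1) · C(ℓ, k)² ≤ 4^ℓ` for EVERY `k` (the tree's `succ_mul_choose_middle_sq_le`
  (`Literature.Barriers.PneNP`, middle coefficient) + Mathlib's `Nat.choose_le_middle`);
* `card_filter_card_eq_choose` — `#{d : Fin ℓ → Bool | #{j : d j} = k} = C(ℓ, k)` (indicator words ↔ `k`-subsets);
* `succ_mul_card_level_sq_le` — hence `(ℓ + 1) · #{d : Fin ℓ → Bool | #{j : d j} = k}² ≤ 4^ℓ`: every level set of the number of
  `true`s among `ℓ` uniform bits has mass `≤ (ℓ + 1)^{-1/2}` — the `C/√ℓ` of (B‴-b).  (The inflate-pair decoder pops iff its two bits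
  differ; `j ↦ (y (2j) xor y (2j+1))` is a 2^ℓ-to-one map onto `Fin ℓ → Bool`, so the same bound holds for the pair-pop count — left to
  the consumer, who owns the bit indexing.)

Honest framing: elementary counting; S11 is a quasi-polynomial (exponent-2) rung and does NOT close stmt-23918 (∀c); VP ≠ VNP is not
touched.  No definitions, no named facts.
-/

-- Sub = Summit single-conjunct layout: the duplicated namespace component is mandated by the tree.
set_option linter.dupNamespace false

namespace Summit.ValiantsHypothesis.ValiantsHypothesis.Theorems.FifoMatching.NNLinearDegreeCofactorHard.PopCount

open Finset

/-- **`(ℓ + 1) · C(ℓ, k)² ≤ 4^ℓ`** for every `k`: the largest binomial point mass is `O(2^ℓ/√ℓ)`. [folklore] -/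
theorem succ_mul_choose_sq_le (ℓ k : ℕ) : (ℓ + 1) * (ℓ.choose k) ^ 2 ≤ 4 ^ ℓ :=
  le_trans (Nat.mul_le_mul_left _ (Nat.pow_le_pow_left (Nat.choose_le_middle k ℓ) 2))
    (Literature.Barriers.PneNP.succ_mul_choose_middle_sq_le ℓ)

/-- **Indicator words with exactly `k` ones are counted by `C(ℓ, k)`.** [folklore] -/
theorem card_filter_card_eq_choose (ℓ k : ℕ) :
    ((univ : Finset (Fin ℓ → Bool)).filter fun d => (univ.filter fun j => d j = true).card = k).card = ℓ.choose k := by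
  classical
  have h : ((univ : Finset (Fin ℓ → Bool)).filter fun d => (univ.filter fun j => d j = true).card = k).card
      = (powersetCard k (univ : Finset (Fin ℓ))).card := by
    refine Finset.card_bij (fun d _ => univ.filter fun j => d j = true) ?_ ?_ ?_
    · intro d hd
      rw [mem_powersetCard]
      exact ⟨filter_subset _ _, (mem_filter.1 hd).2⟩
    · intro d₁ _ d₂ _ h
      funext j
      have hj : (j ∈ univ.filter fun j => d₁ j = true) ↔ (j ∈ univ.filter fun j => d₂ j = true) := by rw [h]
      simp only [mem_filter, mem_univ, true_and] at hj
      exact Bool.eq_iff_iff.2 hj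
    · intro s hs
      refine ⟨fun j => decide (j ∈ s), ?_, ?_⟩
      · rw [mem_filter]
        refine ⟨mem_univ _, ?_⟩
        rw [mem_powersetCard] at hs
        rw [← hs.2]
        congr 1
        ext j
        simp
      · ext j
        simp
  rw [h, card_powersetCard, card_univ, Fintype.card_fin]

/-- **Anti-concentration of the number of ones**: every level set of `#{j : d j}` on `Fin ℓ → Bool` satisfies
`(ℓ + 1) · (#level set)² ≤ 4^ℓ`, i.e. has uniform mass at most `(ℓ + 1)^{-1/2}`. [folklore] -/
theorem succ_mul_card_level_sq_le (ℓ k : ℕ) :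
    (ℓ + 1) * (((univ : Finset (Fin ℓ → Bool)).filter
      fun d => (univ.filter fun j => d j = true).card = k).card) ^ 2 ≤ 4 ^ ℓ := by
  rw [card_filter_card_eq_choose]
  exact succ_mul_choose_sq_le ℓ k

end Summit.ValiantsHypothesis.ValiantsHypothesis.Theorems.FifoMatching.NNLinearDegreeCofactorHard.PopCount
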